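import Mathlib.Geometry.Manifold.Bordism
import Mathlib.Geometry.Manifold.Instances.Real
import Mathlib.Topology.ContinuousMap.Basic
import Literature.Topology.FourManifolds.Cobordism
import HarnessLib

-- provenance: harness21/H21/H21/Prelude/FourManM/Bordism.lean @ 685ab3b (interim HEAD d8f2665); M5 mechanical rewrite
/-!
# Unoriented bordism classes (trunk T-4MAN, prelude `FourManM`)

Notion `bordism_group` (unoriented part) of the G18 outline (`H21/Outlines/FourManM.md`, §C5,
Design D6, review #1).

## Informal content

A *singular `n`-manifold* on a space `X` is a closed smooth `n`-manifold `M` with a continuous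
map `f : M → X`.  Two singular manifolds `(M, f)`, `(N, g)` are *bordant* if there is a compact
`(n+1)`-manifold with boundary `W`, `∂W = M ⊔ N`, and a continuous `F : W → X` restricting to `f`
and `g` on the two ends.  Bordism is an equivalence relation; the set of classes `𝔑ₙ(X)` is an
abelian group under disjoint union in which every element has order `2`, and `𝔑ₙ := 𝔑ₙ(pt)` is
Thom's unoriented bordism group.  Thom, *Quelques propriétés globales des variétés
différentiables*, Comment. Math. Helv. 28 (1954), Ch. IV; Milnor–Stasheff, *Characteristic
classes* (1974), §17 (p. 199 ff.); Atiyah, *Bordism and cobordism*, Proc. Camb. Phil. Soc. 57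
(1961).

## Mathlib

Mathlib has M. Rothgang's `SingularManifold.{u} X k I` (`Mathlib/Geometry/Manifold/Bordism.lean`)
with the operations `map`, `comap`, `empty`, `toPUnit`, `prod`, `sum`, and its module docstring
lays out the roadmap (unoriented bordisms, the bordism relation, bordism groups) which is not yet
in Mathlib.  Charted-space and manifold structures on disjoint unions `M ⊕ N` and on empty types
(`ChartedSpace.empty`, `IsManifold.empty`) are in Mathlib.  Cobordisms `Literature.Cobordism n M N`
(compact Hausdorff `(n+1)`-manifold with boundary `W`, model `𝓡∂ (n + 1)`, with smooth embeddings
of the ends onto `∂W`) come from `Literature.Prelude.FourManM.Cobordism`.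

## Design choices

* **Hausdorff carriers.**  `SingularManifold` has no `T2Space M` field, whereas the total space
  of an `Literature.Topology.FourManifolds.Cobordism` is Hausdorff and its ends are *embedded*; hence a compact non-Hausdorff
  singular manifold is bordant to nothing (not even to itself), and quotienting raw
  `SingularManifold`s would make reflexivity, `zero_add` and `a + a = 0` false.  We therefore
  quotient the one-field extension `Literature.ClosedSingularManifold X n` (`extends SingularManifold X ∞
  (𝓡 n)` with `[t2Space : T2Space M]`, re-exported as an instance following the
  `SingularManifold` pattern), and re-wrap `sum`, `empty`, `map`, `toPUnit` (as `ofManifold`).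
* The relation `ClosedSingularManifold.IsBordant s t` asks for an `Literature.Cobordism n s.M t.M` and a
  continuous extension `F : C(c.W, X)` of `s.f ⊔ t.f`.  Symmetry is real; reflexivity (cylinder),
  transitivity (gluing with collars) and compatibility with disjoint union are theorems with
  `sorry` (the cylinder in the model `𝓡∂ (n + 1)`, collars and gluing are absent from Mathlib).
* `Literature.BordismClass X n` is the `Quot` by `IsBordant`; `zero`, `add` (via `Quot.map₂`) and `map`
  are real definitions whose well-definedness rests on the (partly sorried) `IsBordant` lemmas, and
  the group laws are *theorems*.  Deliberately **no** `AddCommGroup` instance is registered, since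
  its axioms would rest on sorried lemmas.
* `Literature.UnorientedBordismClass.{u} n := BordismClass.{u} PUnit.{u+1} n` is Thom's `𝔑ₙ` as a type;
  e.g. `Nat.card (UnorientedBordismClass.{0} 4) = 4` typechecks (statement file
  `Statements/SPC4/BordismFour.lean`).
* Universes: `ClosedSingularManifold.{u}`, `BordismClass.{u}` are universe polymorphic in the
  carrier, matching `SingularManifold.{u}` and `Literature.Cobordism.{u}` (`u` is the first universe
  argument).

Manifold conventions and the local notation `𝔼 n` are those of the accepted SPC4 files.
-/

-- Matches the project-wide `leanOptions` (guards scratch elaboration outside the package).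
set_option autoImplicit false

open scoped Manifold ContDiff Topology ContinuousMap
open Set Function

noncomputable section

namespace Literature.Topology.FourManifolds

universe u

/-- Local notation: `𝔼 n` is the model Euclidean space `EuclideanSpace ℝ (Fin n)`. -/
local notation "𝔼 " n:arg => EuclideanSpace ℝ (Fin n)

/-! ### Closed (Hausdorff) singular manifolds -/

/-- A *closed singular `n`-manifold* on a topological space `X`: a Mathlib
`SingularManifold X ∞ (𝓡 n)` (a compact boundaryless smooth `n`-manifold `M` with a continuous
map `f : M → X`) whose carrier `M` is moreover Hausdorff.  The extra `T2Space` field is what makes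
bordism (through Hausdorff cobordisms with embedded ends) reflexive; see the module docstring.
Milnor–Stasheff, *Characteristic classes* (1974), §17; Atiyah (1961), §2; design of
M. Rothgang's `SingularManifold`. [cite: Atiyah1961] -/
structure ClosedSingularManifold (X : Type*) [TopologicalSpace X] (n : ℕ)
    extends SingularManifold.{u} X ∞ (𝓡 n) where
  /-- The carrier `M` is Hausdorff. -/
  [t2Space : T2Space M]

attribute [instance] ClosedSingularManifold.t2Space

namespace ClosedSingularManifold

variable {X Y Z : Type*} [TopologicalSpace X] [TopologicalSpace Y] [TopologicalSpace Z] {n : ℕ}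

/-- The disjoint union of two closed singular `n`-manifolds on `X` (wraps
`SingularManifold.sum`; the sum of Hausdorff spaces is Hausdorff).  Milnor–Stasheff (1974), §17. [cite: MilnorStasheff1974] -/
def sum (s t : ClosedSingularManifold.{u} X n) : ClosedSingularManifold.{u} X n where
  toSingularManifold := s.toSingularManifold.sum t.toSingularManifold
  t2Space := inferInstanceAs (T2Space (s.M ⊕ t.M))

/-- The carrier of a disjoint union is the disjoint union of the carriers. [folklore] -/
@[simp]
theorem sum_M (s t : ClosedSingularManifold.{u} X n) : (s.sum t).M = (s.M ⊕ t.M) :=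
  rfl

/-- The structure map of a disjoint union is `Sum.elim` of the structure maps. [folklore] -/
@[simp]
theorem sum_f (s t : ClosedSingularManifold.{u} X n) : (s.sum t).f = Sum.elim s.f t.f :=
  rfl

variable (X n) in
/-- The empty closed singular `n`-manifold on `X`, with carrier `PEmpty` (wraps
`SingularManifold.empty`, using Mathlib's `ChartedSpace.empty` and the instances
`IsManifold.empty`, `BoundarylessManifold.of_empty`).  It represents the zero bordism class.
Milnor–Stasheff (1974), §17. [cite: MilnorStasheff1974] -/
def empty : ClosedSingularManifold.{u} X n :=
  letI := ChartedSpace.empty (𝔼 n) (PEmpty.{u + 1})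
  { toSingularManifold := SingularManifold.empty X PEmpty.{u + 1} (𝓡 n)
    t2Space := inferInstanceAs (T2Space PEmpty.{u + 1}) }

/-- The carrier of the empty singular manifold is `PEmpty`. [folklore] -/
@[simp]
theorem empty_M : (empty.{u} X n).M = PEmpty.{u + 1} :=
  rfl

/-- The carrier of the empty singular manifold is empty. [folklore] -/
instance : IsEmpty (empty.{u} X n).M :=
  inferInstanceAs (IsEmpty PEmpty.{u + 1})

/-- Push a closed singular manifold on `X` forward along a continuous map `φ : C(X, Y)`
(wraps `SingularManifold.map`; functoriality of bordism, Atiyah (1961), §2). [cite: Atiyah1961] -/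
def map (φ : C(X, Y)) (s : ClosedSingularManifold.{u} X n) : ClosedSingularManifold.{u} Y n where
  toSingularManifold := s.toSingularManifold.map φ.continuous
  t2Space := inferInstanceAs (T2Space s.M)

/-- `map` does not change the carrier. [folklore] -/
@[simp]
theorem map_M (φ : C(X, Y)) (s : ClosedSingularManifold.{u} X n) : (s.map φ).M = s.M :=
  rfl

/-- The structure map of `s.map φ` is `φ ∘ s.f`. [folklore] -/
@[simp]
theorem map_f (φ : C(X, Y)) (s : ClosedSingularManifold.{u} X n) : (s.map φ).f = φ ∘ s.f :=
  rfl

/-- `map` sends the empty singular manifold to the empty singular manifold. [folklore] -/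
@[simp]
theorem map_empty (φ : C(X, Y)) : (empty X n).map φ = empty Y n := by
  simp only [map, empty, SingularManifold.map, SingularManifold.empty, mk.injEq,
    SingularManifold.mk.injEq, heq_eq_eq, true_and]
  exact ⟨rfl, funext fun x => x.elim⟩

/-- `map` commutes with disjoint unions. [folklore] -/
theorem map_sum (φ : C(X, Y)) (s t : ClosedSingularManifold.{u} X n) :
    (s.sum t).map φ = (s.map φ).sum (t.map φ) := by
  simp only [map, sum, SingularManifold.map, SingularManifold.sum, mk.injEq,
    SingularManifold.mk.injEq, heq_eq_eq, true_and]
  exact ⟨rfl, HEq.rfl, Sum.comp_elim φ s.f t.f⟩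

variable (n) in
/-- A closed smooth `n`-manifold `M` as a closed singular manifold on the point (wraps
`SingularManifold.toPUnit`); its bordism class is `[M] ∈ 𝔑ₙ`.  Thom (1954), Ch. IV. [cite: Thom1954] -/
def ofManifold (M : Type u) [TopologicalSpace M] [T2Space M] [ChartedSpace (𝔼 n) M]
    [IsManifold (𝓡 n) ∞ M] [CompactSpace M] [BoundarylessManifold (𝓡 n) M] :
    ClosedSingularManifold.{u} PUnit.{u + 1} n where
  toSingularManifold := SingularManifold.toPUnit M (𝓡 n)
  t2Space := inferInstanceAs (T2Space M)

/-- The carrier of `ofManifold n M` is `M`. [folklore] -/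
@[simp]
theorem ofManifold_M (M : Type u) [TopologicalSpace M] [T2Space M] [ChartedSpace (𝔼 n) M]
    [IsManifold (𝓡 n) ∞ M] [CompactSpace M] [BoundarylessManifold (𝓡 n) M] :
    (ofManifold n M).M = M :=
  rfl

/-! ### The bordism relation -/

/-- Two closed singular `n`-manifolds `s = (M, f)`, `t = (N, g)` on `X` are *bordant* if there
is a cobordism `W` from `M` to `N` (an `Literature.Cobordism n s.M t.M`) and a continuous map
`F : W → X` extending `f` and `g` along the two boundary inclusions.  Milnor–Stasheff,
*Characteristic classes* (1974), §17; Atiyah, *Bordism and cobordism* (1961), §2;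
Thom (1954), Ch. IV. [cite: Thom1954] -/
def IsBordant (s t : ClosedSingularManifold.{u} X n) : Prop :=
  ∃ (c : Cobordism n s.M t.M) (F : C(c.W, X)), (∀ x, F (c.inl x) = s.f x) ∧ ∀ y, F (c.inr y) = t.f y

/-- Bordism is symmetric: reverse the cobordism (`Literature.Topology.FourManifolds.Cobordism.symm`).
Milnor–Stasheff (1974), §17. [cite: MilnorStasheff1974] -/
theorem IsBordant.symm {s t : ClosedSingularManifold.{u} X n} (h : IsBordant s t) :
    IsBordant t s := by
  obtain ⟨c, F, hl, hr⟩ := h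
  exact ⟨c.symm, F, hr, hl⟩

/-- Bordism is symmetric, `iff` form. [folklore] -/
theorem isBordant_comm (s t : ClosedSingularManifold.{u} X n) : IsBordant s t ↔ IsBordant t s :=
  ⟨IsBordant.symm, IsBordant.symm⟩

/-- Bordism is reflexive: the cylinder `M × [0, 1]` with `F = f ∘ pr₁` is a bordism from
`(M, f)` to itself (Milnor–Stasheff (1974), §17).  This uses that `s.M` is Hausdorff.  `sorry`:
re-charting the cylinder to the model `𝓡∂ (n + 1)` is absent from Mathlib
(cf. `Literature.Topology.FourManifolds.isCobordant_refl`). [cite: MilnorStasheff1974] -/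
def isBordant_refl : Prop :=
  ∀ (s : ClosedSingularManifold.{u} X n),
    IsBordant s s

/-- Bordism is transitive: glue the two cobordisms along the common end using collars and
extend the maps to `X` (Milnor–Stasheff (1974), §17; Milnor, *Lectures on the h-cobordism
theorem* (1965), Thm 1.4).  `sorry`: collars and gluing are absent from Mathlib
(cf. `Literature.Topology.FourManifolds.IsCobordant.trans`). [cite: MilnorStasheff1974] -/
def IsBordant.trans : Prop :=
  ∀ {s t r : ClosedSingularManifold.{u} X n} (h₁ : IsBordant s t) (h₂ : IsBordant t r),
    IsBordant s r

variable (X n) in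
/-- Bordism is an equivalence relation on closed singular `n`-manifolds on `X`
(Milnor–Stasheff (1974), Lemma 17.1), from the named facts `isBordant_refl` and
`IsBordant.trans` (hypotheses `hrefl`, `htrans`) and the proved `IsBordant.symm`. [cite: MilnorStasheff1974, Lemma 17.1] -/
theorem equivalence_isBordant (hrefl : isBordant_refl.{u} (X := X) (n := n))
    (htrans : IsBordant.trans.{u} (X := X) (n := n)) :
    Equivalence (IsBordant.{u} (X := X) (n := n)) :=
  ⟨hrefl, IsBordant.symm, fun h₁ h₂ => htrans h₁ h₂⟩

/-- Bordant singular manifolds have cobordant carriers. [folklore] -/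
theorem IsBordant.isCobordant {s t : ClosedSingularManifold.{u} X n} (h : IsBordant s t) :
    IsCobordant n s.M t.M :=
  h.elim fun c _ => ⟨c⟩

/-- Bordism is compatible with disjoint union: the disjoint union of two bordisms is a bordism
between the disjoint unions (Milnor–Stasheff (1974), §17).  `sorry`: assembling the
`𝓡∂ (n + 1)`-manifold structure and the boundary of `W₁ ⊕ W₂` into an `Literature.Topology.FourManifolds.Cobordism` is routine
but lengthy (Mathlib has the charted-space structure on sums and `boundary_disjointUnion`). [cite: MilnorStasheff1974] -/
def IsBordant.sum : Prop :=
  ∀ {s s' t t' : ClosedSingularManifold.{u} X n} (hs : IsBordant s s') (ht : IsBordant t t'),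
    IsBordant (s.sum t) (s'.sum t')

/-- Every singular manifold has order two up to bordism: `(M ⊔ M, f ⊔ f)` bounds the cylinder
`M × [0, 1]`, so it is bordant to the empty singular manifold (Milnor–Stasheff (1974), §17;
Thom (1954)).  `sorry`: cylinder in the model `𝓡∂ (n + 1)`. [cite: MilnorStasheff1974] -/
def isBordant_sum_self_empty : Prop :=
  ∀ (s : ClosedSingularManifold.{u} X n),
    IsBordant (s.sum s) (empty X n)

/-- Disjoint union is commutative up to bordism (the cylinder on `M ⊔ N`, with ends identified
via `Sum.swap`).  Milnor–Stasheff (1974), §17.  `sorry`: cylinder. [cite: MilnorStasheff1974] -/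
def isBordant_sum_comm : Prop :=
  ∀ (s t : ClosedSingularManifold.{u} X n),
    IsBordant (s.sum t) (t.sum s)

/-- Disjoint union is associative up to bordism (the cylinder, with ends identified via
`Equiv.sumAssoc`).  Milnor–Stasheff (1974), §17.  `sorry`: cylinder. [cite: MilnorStasheff1974] -/
def isBordant_sum_assoc : Prop :=
  ∀ (s t r : ClosedSingularManifold.{u} X n),
    IsBordant ((s.sum t).sum r) (s.sum (t.sum r))

/-- The empty singular manifold is a right unit for disjoint union up to bordism (the cylinder
on `M`, whose outgoing end is `M ≅ M ⊔ ∅`).  Milnor–Stasheff (1974), §17.  `sorry`: cylinder. [cite: MilnorStasheff1974] -/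
def isBordant_sum_empty : Prop :=
  ∀ (s : ClosedSingularManifold.{u} X n),
    IsBordant (s.sum (empty X n)) s

/-- The empty singular manifold is a left unit for disjoint union up to bordism.
Milnor–Stasheff (1974), §17.  From the named facts `isBordant_sum_comm`, `isBordant_sum_empty`,
`IsBordant.trans` (hypotheses). [cite: MilnorStasheff1974, §17] -/
theorem isBordant_empty_sum (htrans : IsBordant.trans.{u} (X := X) (n := n))
    (hcomm : isBordant_sum_comm.{u} (X := X) (n := n))
    (hempty : isBordant_sum_empty.{u} (X := X) (n := n))
    (s : ClosedSingularManifold.{u} X n) : IsBordant ((empty X n).sum s) s :=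
  htrans (hcomm _ _) (hempty s)

/-- The named bordism facts of this file whose proofs are deferred (cylinders, collars and gluing
in the model `𝓡∂ (n + 1)` are absent from Mathlib), bundled as a `Prop`-valued class so that the
group structure on bordism classes below can consume them as one instance hypothesis
`[BordismFacts X n]`. Milnor–Stasheff (1974), §17, Lemma 17.1. [cite: MilnorStasheff1974, §17] -/
class BordismFacts (X : Type*) [TopologicalSpace X] (n : ℕ) : Prop where
  /-- `isBordant_refl`. -/
  refl : isBordant_refl.{u} (X := X) (n := n)
  /-- `IsBordant.trans`. -/
  trans : IsBordant.trans.{u} (X := X) (n := n)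
  /-- `IsBordant.sum`. -/
  sum : IsBordant.sum.{u} (X := X) (n := n)
  /-- `isBordant_sum_self_empty`. -/
  sum_self_empty : isBordant_sum_self_empty.{u} (X := X) (n := n)
  /-- `isBordant_sum_comm`. -/
  sum_comm : isBordant_sum_comm.{u} (X := X) (n := n)
  /-- `isBordant_sum_assoc`. -/
  sum_assoc : isBordant_sum_assoc.{u} (X := X) (n := n)
  /-- `isBordant_sum_empty`. -/
  sum_empty : isBordant_sum_empty.{u} (X := X) (n := n)

/-- Bordism is functorial: if `s ∼ t` on `X` via `(W, F)` then `s.map φ ∼ t.map φ` on `Y` via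
`(W, φ ∘ F)`.  Atiyah, *Bordism and cobordism* (1961), §2. [folklore] -/
theorem IsBordant.map (φ : C(X, Y)) {s t : ClosedSingularManifold.{u} X n} (h : IsBordant s t) :
    IsBordant (s.map φ) (t.map φ) := by
  obtain ⟨c, F, hl, hr⟩ := h
  exact ⟨c, φ.comp F, fun x => by simp [hl x], fun y => by simp [hr y]⟩

end ClosedSingularManifold

/-! ### Bordism classes -/

/-- The set `𝔑ₙ(X)` of *bordism classes* of closed singular `n`-manifolds on `X`: the quotient
of `Literature.ClosedSingularManifold X n` by the bordism relation `IsBordant`.  With disjoint union it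
is an abelian group of exponent `2` (group laws below, as theorems).  Thom (1954), Ch. IV;
Milnor–Stasheff, *Characteristic classes* (1974), §17; Atiyah (1961), §2; roadmap of Mathlib's
`Bordism.lean`. [cite: Thom1954] -/
def BordismClass (X : Type*) [TopologicalSpace X] (n : ℕ) :=
  Quot (ClosedSingularManifold.IsBordant.{u} (X := X) (n := n))

namespace BordismClass

variable {X Y Z : Type*} [TopologicalSpace X] [TopologicalSpace Y] [TopologicalSpace Z] {n : ℕ}

/-- The bordism class `[M, f]` of a closed singular manifold.  Milnor–Stasheff (1974), §17. [cite: MilnorStasheff1974] -/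
def mk (s : ClosedSingularManifold.{u} X n) : BordismClass.{u} X n :=
  Quot.mk _ s

/-- Every bordism class is the class of some closed singular manifold. [folklore] -/
theorem mk_surjective : Surjective (mk : ClosedSingularManifold.{u} X n → BordismClass X n) :=
  Quot.mk_surjective

/-- Induction principle: to prove a property of all bordism classes it suffices to prove it for
classes of closed singular manifolds. [folklore] -/
@[elab_as_elim]
theorem ind {p : BordismClass.{u} X n → Prop} (h : ∀ s, p (mk s)) (a : BordismClass X n) : p a :=
  Quot.ind h a

/-- Bordant singular manifolds have equal bordism classes. [folklore] -/
theorem sound {s t : ClosedSingularManifold.{u} X n} (h : s.IsBordant t) : mk s = mk t :=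
  Quot.sound h

/-- Two singular manifolds have the same bordism class iff they are bordant
(Milnor–Stasheff (1974), Lemma 17.1).  Relies on: `equivalence_isBordant` (from the facts
`[BordismFacts X n]`). [cite: MilnorStasheff1974, Lemma 17.1] -/
theorem mk_eq_mk_iff [ClosedSingularManifold.BordismFacts.{u} X n]
    {s t : ClosedSingularManifold.{u} X n} : mk s = mk t ↔ s.IsBordant t :=
  ⟨fun h =>
    (ClosedSingularManifold.equivalence_isBordant X n ClosedSingularManifold.BordismFacts.refl
      ClosedSingularManifold.BordismFacts.trans).eqvGen_iff.mp (Quot.eqvGen_exact h), sound⟩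

variable (X n) in
/-- The zero bordism class: the class of the empty singular manifold.
Milnor–Stasheff (1974), §17. [cite: MilnorStasheff1974] -/
def zero : BordismClass.{u} X n :=
  mk (ClosedSingularManifold.empty X n)

/-- The zero of `𝔑ₙ(X)` is the class of the empty singular manifold (`BordismClass.zero`). [folklore] -/
instance : Zero (BordismClass.{u} X n) :=
  ⟨zero X n⟩

/-- `0 = [∅]`. [folklore] -/
theorem zero_def : (0 : BordismClass.{u} X n) = mk (ClosedSingularManifold.empty X n) :=
  rfl

/-- Addition of bordism classes, induced by disjoint union of singular manifolds
(Milnor–Stasheff (1974), §17).  Relies on: `ClosedSingularManifold.IsBordant.sum`,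
`ClosedSingularManifold.isBordant_refl` (facts, via `[BordismFacts X n]`). [cite: MilnorStasheff1974, §17] -/
def add [ClosedSingularManifold.BordismFacts.{u} X n] :
    BordismClass.{u} X n → BordismClass.{u} X n → BordismClass.{u} X n :=
  Quot.map₂ ClosedSingularManifold.sum
    (fun s _ _ h => ClosedSingularManifold.BordismFacts.sum (ClosedSingularManifold.BordismFacts.refl s) h)
    (fun _ _ t h => ClosedSingularManifold.BordismFacts.sum h (ClosedSingularManifold.BordismFacts.refl t))

/-- Addition on `𝔑ₙ(X)` is disjoint union of representatives (`BordismClass.add`). [folklore] -/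
instance [ClosedSingularManifold.BordismFacts.{u} X n] : Add (BordismClass.{u} X n) :=
  ⟨add⟩

/-- `[M, f] + [N, g] = [M ⊔ N, f ⊔ g]`. [folklore] -/
@[simp]
theorem mk_add_mk [ClosedSingularManifold.BordismFacts.{u} X n] (s t : ClosedSingularManifold.{u} X n) :
    mk s + mk t = mk (s.sum t) :=
  rfl

/-- `[M ⊔ N] = [M] + [N]` (Milnor–Stasheff (1974), §17). [cite: MilnorStasheff1974] -/
theorem mk_sum [ClosedSingularManifold.BordismFacts.{u} X n] (s t : ClosedSingularManifold.{u} X n) :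
    mk (s.sum t) = mk s + mk t :=
  rfl

/-- Addition of bordism classes is commutative (Milnor–Stasheff (1974), §17).
Relies on: `isBordant_sum_comm` (fact, via `[BordismFacts X n]`). [cite: MilnorStasheff1974, §17] -/
protected theorem add_comm [ClosedSingularManifold.BordismFacts.{u} X n] (a b : BordismClass.{u} X n) :
    a + b = b + a := by
  induction a using ind with | h s => ?_
  induction b using ind with | h t => ?_
  exact sound (ClosedSingularManifold.BordismFacts.sum_comm s t)

/-- Addition of bordism classes is associative (Milnor–Stasheff (1974), §17).
Relies on: `isBordant_sum_assoc` (fact, via `[BordismFacts X n]`). [cite: MilnorStasheff1974, §17] -/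
protected theorem add_assoc [ClosedSingularManifold.BordismFacts.{u} X n] (a b c : BordismClass.{u} X n) :
    a + b + c = a + (b + c) := by
  induction a using ind with | h s => ?_
  induction b using ind with | h t => ?_
  induction c using ind with | h r => ?_
  exact sound (ClosedSingularManifold.BordismFacts.sum_assoc s t r)

/-- `0 + a = a` in `𝔑ₙ(X)` (Milnor–Stasheff (1974), §17).
Relies on: `isBordant_empty_sum` (via `[BordismFacts X n]`). [cite: MilnorStasheff1974, §17] -/
protected theorem zero_add [ClosedSingularManifold.BordismFacts.{u} X n] (a : BordismClass.{u} X n) :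
    0 + a = a := by
  induction a using ind with | h s => ?_
  exact sound (ClosedSingularManifold.isBordant_empty_sum ClosedSingularManifold.BordismFacts.trans
    ClosedSingularManifold.BordismFacts.sum_comm ClosedSingularManifold.BordismFacts.sum_empty s)

/-- `a + 0 = a` in `𝔑ₙ(X)` (Milnor–Stasheff (1974), §17).
Relies on: `isBordant_sum_empty` (fact, via `[BordismFacts X n]`). [cite: MilnorStasheff1974, §17] -/
protected theorem add_zero [ClosedSingularManifold.BordismFacts.{u} X n] (a : BordismClass.{u} X n) :
    a + 0 = a := by
  induction a using ind with | h s => ?_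
  exact sound (ClosedSingularManifold.BordismFacts.sum_empty s)

/-- Every bordism class has order `2`: `a + a = 0`, since `M ⊔ M` bounds `M × [0, 1]`
(Thom (1954); Milnor–Stasheff (1974), §17).  Relies on: `isBordant_sum_self_empty` (fact, via
`[BordismFacts X n]`). [cite: Thom1954] -/
theorem add_self_eq_zero [ClosedSingularManifold.BordismFacts.{u} X n] (a : BordismClass.{u} X n) :
    a + a = 0 := by
  induction a using ind with | h s => ?_
  exact sound (ClosedSingularManifold.BordismFacts.sum_self_empty s)

/-- Functoriality of bordism classes: push forward along a continuous map `φ : C(X, Y)`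
(Atiyah (1961), §2).  Relies on: `ClosedSingularManifold.IsBordant.map` (proved). [cite: Atiyah1961] -/
def map (φ : C(X, Y)) : BordismClass.{u} X n → BordismClass.{u} Y n :=
  Quot.map (ClosedSingularManifold.map φ) fun _ _ h => h.map φ

/-- `map φ [M, f] = [M, φ ∘ f]`. [folklore] -/
@[simp]
theorem map_mk (φ : C(X, Y)) (s : ClosedSingularManifold.{u} X n) :
    map φ (mk s) = mk (s.map φ) :=
  rfl

/-- `map φ` preserves `0` (the empty singular manifold is mapped to the empty one). [folklore] -/
@[simp]
theorem map_zero (φ : C(X, Y)) : map φ (0 : BordismClass.{u} X n) = 0 := by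
  rw [zero_def, map_mk, ClosedSingularManifold.map_empty, zero_def]

/-- `map φ` is additive (it commutes with disjoint unions on representatives). [folklore] -/
theorem map_add [ClosedSingularManifold.BordismFacts.{u} X n] [ClosedSingularManifold.BordismFacts.{u} Y n]
    (φ : C(X, Y)) (a b : BordismClass.{u} X n) :
    map φ (a + b) = map φ a + map φ b := by
  induction a using ind with | h s => ?_
  induction b using ind with | h t => ?_
  simp only [mk_add_mk, map_mk, ClosedSingularManifold.map_sum]

end BordismClass

/-! ### Thom's unoriented bordism group `𝔑ₙ` -/

/-- Thom's *unoriented bordism group* `𝔑ₙ` as a type: bordism classes of closed smooth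
`n`-manifolds, i.e. `BordismClass PUnit n`.  Thom, Comment. Math. Helv. 28 (1954), Ch. IV
(`𝔑₄ ≅ (ℤ/2)²`); Milnor–Stasheff (1974), §17. [cite: MilnorStasheff1974] -/
abbrev UnorientedBordismClass (n : ℕ) := BordismClass.{u} PUnit.{u + 1} n

/-- The unoriented bordism class `[M] ∈ 𝔑ₙ` of a closed smooth `n`-manifold `M`.
Thom (1954), Ch. IV. [cite: Thom1954] -/
def UnorientedBordismClass.mk {n : ℕ} (M : Type u) [TopologicalSpace M] [T2Space M]
    [ChartedSpace (𝔼 n) M] [IsManifold (𝓡 n) ∞ M] [CompactSpace M]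
    [BoundarylessManifold (𝓡 n) M] : UnorientedBordismClass.{u} n :=
  BordismClass.mk (ClosedSingularManifold.ofManifold n M)

/-- `UnorientedBordismClass.mk M` is the bordism class of `ofManifold n M`. [folklore] -/
theorem UnorientedBordismClass.mk_eq {n : ℕ} (M : Type u) [TopologicalSpace M] [T2Space M]
    [ChartedSpace (𝔼 n) M] [IsManifold (𝓡 n) ∞ M] [CompactSpace M]
    [BoundarylessManifold (𝓡 n) M] :
    UnorientedBordismClass.mk M = BordismClass.mk (ClosedSingularManifold.ofManifold n M) :=
  rfl

end Literature.Topology.FourManifolds
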